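import Summits.BirchSwinnertonDyer.BirchSwinnertonDyer.Theorems.PrintCFramBottomClassIndexLawFiveLeBorelDepthEigenTargets
import HarnessLib

/-!
# Route `PrintCFram`, crux C2 `BottomClassIndexLawFiveLe` (stmt-BirchSwinnertonDyer-20372), line
# `eisenstein-resource-bdp-line` (stub `stub_kolyvaginUpper_borelCM_pairSum_offKrizLi`, input (γ)):
# **THE BOREL `cebotarev` AXIOM** — McCallum's Cor. 3.2 in EXACTLY the shape of
# `KolyvaginDescent.HypothesesM.cebotarev`, for families whose prescribed members have the
# admissible top sign
# (cell `bsd-print-cfram`, seat `bsd-line-cfram-p1-w2` g6; helper `--supports` 20372; 0 facts, 0 defs)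

HONEST FRAMING. Nothing about BSD is proved here, and nothing of the stub itself. The descent
`KolyvaginDescent.HypothesesM` asks (`cebotarev`): for eigenclasses `c_i` and exponents `N_i ≤ ord`,
a Kolyvagin prime `ℓ > b` with `p^{N_i} c_i ∈ A ℓ` and `N_i ≠ 0 → p^{N_i−1} c_i ∉ A ℓ`. FILE 6
(`exists_kolyvaginPrime_gt_pow_orders_of_cmRamified`) gives prescribed orders at the Borel prime for
requested DEPTHS of the right parity; this file repackages it in the descent's EXPONENT language
(`exists_kolyvaginPrime_gt_pow_cebotarevShape_of_cmRamified`): for `c_*`-eigenclasses `x_i` with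
exact `𝓞`-depths `e_i` (independent top layers) and exponents `N_i ≤ ⌈e_i/2⌉ = ord`, such that
every member with `N_i ≠ 0` has TOP SIGN matching its depth parity (`ν_i = (−1)^{e_i−1} η_line` —
automatic for sign `η_line` and odd depth and for sign `−η_line` and even depth; i.e. every class
except the `(−η_line)`-classes of ODD depth), there are Kolyvagin primes `ℓ` above every bound with
`p^{N_i} x_i ∈ ker loc_λ` and `N_i ≠ 0 → p^{N_i−1} x_i ∉ ker loc_λ`. Members with `N_i = 0` are
unrestricted (target `0`). This is the largest fragment of the axiom that holds at the Borel prime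
(FILE 5: depth-1 classes of sign `−η_line` refute the rest; odd-depth `−η_line`-classes get one
step less, FILE 6). THEOREMS ONLY; no definition, no named fact, no `sorry`. BSD is not proved by
any of this; no summit statement is proved by this seat. Reference: [McCallumLMS1991] §3 Cor. 3.2.
-/

set_option autoImplicit false
-- `…BirchSwinnertonDyer.BirchSwinnertonDyer.Theorems…` is the problem's mandated namespace (D-0017).
set_option linter.dupNamespace false

noncomputable section

open scoped Classical

namespace Summit.BirchSwinnertonDyer.BirchSwinnertonDyer.Theorems.PrintCFram.BorelKolyvaginPairing

open WeierstrassCurve NumberField IsDedekindDomain Field Literature.NumberTheory.EllipticCurves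
  Literature.NumberTheory.GaloisRepresentations Literature.NumberTheory.EllipticCurves.Rank1Residual
  Summit.BirchSwinnertonDyer.BirchSwinnertonDyer.Theorems.PrintCFram.BorelHomothety

variable (W : WeierstrassCurve ℚ) [W.IsElliptic] (p : ℕ) [hp : Fact p.Prime]
variable {K : Type} [Field K] [NumberField K]

/-- `(−1)^(a + 2k) = (−1)^a`. [folklore] -/
theorem neg_one_pow_add_two_mul (a k : ℕ) : ((-1 : ℤ) ^ (a + 2 * k)) = (-1) ^ a := by
  rw [pow_add, pow_mul, neg_one_sq, one_pow, mul_one]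

/-- **The Borel `cebotarev` axiom (McCallum Cor. 3.2 in the descent's exponent shape).** `W` CM,
`5 ≤ p` CM-ramified, `𝓞_𝔭`-structure `(s, μ, m)`; `K` imaginary quadratic with complex conjugation `c`
lifted along `c₀`; `η = ±1` the sign of `c₀` on `ker μ`; `M ≥ 1`; `c_*`-eigenclasses `x_i` (signs
`ν_i`) with exact `𝓞`-depths `e_i` and independent top layers; exponents `N_i ≤ ⌈e_i/2⌉` such that
`N_i ≠ 0 → ν_i = (−1)^{e_i−1} η` (top sign admissible). Then above every `b` there is a Kolyvagin
prime `ℓ` of level `p^M` with, at its place, **`p^{N_i} x_i ∈ ker loc_λ` and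
`N_i ≠ 0 → p^{N_i−1} x_i ∉ ker loc_λ`** for every `i`. [cite: McCallumLMS1991, §3 Cor. 3.2] -/
theorem exists_kolyvaginPrime_gt_pow_cebotarevShape_of_cmRamified
    (hC : Literature.NumberTheory.Automorphic.chebotarev_artinRep) {N : ℕ} [NeZero N]
    (hCM : W.HasCM) (h5 : 5 ≤ p) (hram : CMRamified W p)
    {s : AlgebraicClosure ℚ} {μ : AddMonoid.End W.geomPoints} {m : ℤ}
    (hs : s ^ 2 = ((-(p : ℤ) : ℤ) : AlgebraicClosure ℚ)) (hm : m.natAbs = p)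
    (hμμ : ∀ P, μ (μ P) = m • P)
    (hcomm : ∀ g : absoluteGaloisGroup ℚ, g • s = s → ∀ P, μ (g • P) = g • μ P)
    (hanti : ∀ g : absoluteGaloisGroup ℚ, g • s = -s → ∀ P, μ (g • P) = -(g • μ P))
    (hK : IsImaginaryQuadratic K) {M : ℕ} (hM : 1 ≤ M) {c : K ≃ₐ[ℚ] K}
    {c₀ : absoluteGaloisGroup ℚ} (hc₀ : IsComplexConjugation (Rat.castHom ℝ) c₀)
    (ht : IsLiftOfAut c (absGaloisTransport (K := ℚ) (L := K) c₀).toRingEquiv)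
    {η : ℤ} (hηs : η = 1 ∨ η = -1) (hη : ∀ P : W.geomPoints, μ P = 0 → c₀ • P = η • P)
    {ι : Type*} [Fintype ι] (xs : ι → galH1Torsion (W.baseChange K) ((p ^ M : ℕ) : ℤ))
    {ν : ι → ℤ} (hxs : ∀ i, conjAct W c ((p ^ M : ℕ) : ℤ) (xs i) = ν i • xs i) (e : ι → ℕ)
    (he : ∀ i, ∀ ρ ∈ torsionFixing (W.baseChange K) ((p ^ M : ℕ) : ℤ),
      (μ ^ e i) ((RatClosure.torsionEquiv (K := K) W ((p ^ M : ℕ) : ℤ)).symm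
        (h1Eval (W.baseChange K) ((p ^ M : ℕ) : ℤ) (xs i) ρ) : W.geomPoints) = 0)
    (hind : ∀ c : ι → ℤ,
      (∀ ρ ∈ torsionFixing (W.baseChange K) ((p ^ M : ℕ) : ℤ),
        ∑ i, c i • (μ ^ (e i - 1)) ((RatClosure.torsionEquiv (K := K) W ((p ^ M : ℕ) : ℤ)).symm
          (h1Eval (W.baseChange K) ((p ^ M : ℕ) : ℤ) (xs i) ρ) : W.geomPoints) = 0) →
        ∀ i, 0 < e i → (p : ℤ) ∣ c i)
    (Nv : ι → ℕ) (hN : ∀ i, Nv i ≤ (e i + 1) / 2)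
    (hsign : ∀ i, Nv i ≠ 0 → ν i = (-1) ^ (e i - 1) * η) (b : ℕ) :
    ∃ ℓ : ℕ, b < ℓ ∧ ℓ.Prime ∧ ¬ ℓ ∣ N ∧ ¬ ((ℓ : ℤ) ∣ NumberField.discr K) ∧ ℓ ≠ p ∧
      (Ideal.span {(ℓ : 𝓞 K)}).IsPrime ∧ FrobEqFrobInfty W K (p ^ M) ℓ ∧
      ∀ i, ∀ v : HeightOneSpectrum (𝓞 K), (ℓ : 𝓞 K) ∈ v.asIdeal →
        ((p : ℤ) ^ Nv i) • xs i ∈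
            (W.baseChange K).torsionLocalKer (v.adicCompletion K) ((p ^ M : ℕ) : ℤ) ∧
          (Nv i ≠ 0 → ((p : ℤ) ^ (Nv i - 1)) • xs i ∉
            (W.baseChange K).torsionLocalKer (v.adicCompletion K) ((p ^ M : ℕ) : ℤ)) := by
  have hpr : p.Prime := hp.out
  have hp2 : p ≠ 2 := by omega
  have hinv : ∀ y, (absGaloisTransport (K := ℚ) (L := K) c₀).toRingEquiv
      ((absGaloisTransport (K := ℚ) (L := K) c₀).toRingEquiv y) = y := fun y ↦
    RatClosure.absGaloisTransport_absGaloisTransport_of_sq_eq_one hc₀.sq_eq_one y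
  -- a top value for each class with `e i > 0`
  have htop : ∀ i, 0 < e i → ∃ ρ ∈ torsionFixing (W.baseChange K) ((p ^ M : ℕ) : ℤ),
      (μ ^ (e i - 1)) (((RatClosure.torsionEquiv (K := K) W ((p ^ M : ℕ) : ℤ)).symm
        (h1Eval (W.baseChange K) ((p ^ M : ℕ) : ℤ) (xs i) ρ)) : W.geomPoints) ≠ 0 := by
    intro i hei
    by_contra hall
    push Not at hall
    have h1 := hind (Pi.single i 1) (fun ρ hρ ↦ by
      rw [Finset.sum_eq_single i (fun j _ hj ↦ by rw [Pi.single_eq_of_ne hj, zero_smul])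
        (fun h ↦ absurd (Finset.mem_univ i) h), Pi.single_eq_same, one_smul]
      exact hall ρ hρ) i hei
    rw [Pi.single_eq_same] at h1
    exact hpr.one_lt.ne' (by exact_mod_cast Int.eq_one_of_dvd_one (Int.natCast_nonneg p) h1)
  -- the targets: `0` where `N_i = 0`, else a `ν_i`-eigenvector of exact depth `d_i`, `⌈d_i/2⌉ = N_i`
  have htarget : ∀ i, ∃ T : geomTorsion (W.baseChange K) ((p ^ M : ℕ) : ℤ),
      (μ ^ e i) (((RatClosure.torsionEquiv (K := K) W ((p ^ M : ℕ) : ℤ)).symm T :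
        W.geomTorsion ((p ^ M : ℕ) : ℤ)) : W.geomPoints) = 0 ∧
      ht.torsionMap W ((p ^ M : ℕ) : ℤ) T = ν i • T ∧
      ∀ a : ℕ, ((p : ℤ) ^ a) • T = 0 ↔ Nv i ≤ a := by
    intro i
    by_cases hNi : Nv i = 0
    · refine ⟨0, by rw [map_zero, ZeroMemClass.coe_zero, map_zero], by rw [map_zero, smul_zero],
        fun a ↦ ?_⟩
      rw [smul_zero, hNi]
      exact ⟨fun _ ↦ Nat.zero_le a, fun _ ↦ rfl⟩
    -- `N_i ≥ 1`: depth `d = e_i - 2 (⌈e_i/2⌉ - N_i)`, same parity as `e_i`, `⌈d/2⌉ = N_i`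
    have hNle := hN i
    have hei : 0 < e i := by
      by_contra h0
      have : e i = 0 := by omega
      rw [this] at hNle
      omega
    obtain ⟨ρ₁, hρ₁, hρ₁top⟩ := htop i hei
    set d : ℕ := e i - 2 * ((e i + 1) / 2 - Nv i) with hd
    have hd1 : 1 ≤ d := by omega
    have hde : d ≤ e i := by omega
    have hdN : (d + 1) / 2 = Nv i := by omega
    have hpar : (-1 : ℤ) ^ (d - 1) = (-1) ^ (e i - 1) := by
      rw [show e i - 1 = (d - 1) + 2 * ((e i + 1) / 2 - Nv i) by omega, neg_one_pow_add_two_mul]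
    -- `t₀` of exact depth `d` from the top value
    set X : W.geomPoints := (((RatClosure.torsionEquiv (K := K) W ((p ^ M : ℕ) : ℤ)).symm
      (h1Eval (W.baseChange K) ((p ^ M : ℕ) : ℤ) (xs i) ρ₁)) : W.geomPoints) with hX
    have hX_M : X ∈ W.geomTorsion ((p ^ M : ℕ) : ℤ) :=
      ((RatClosure.torsionEquiv (K := K) W ((p ^ M : ℕ) : ℤ)).symm
        (h1Eval (W.baseChange K) ((p ^ M : ℕ) : ℤ) (xs i) ρ₁)).2
    have ht₀M : (μ ^ (e i - d)) X ∈ W.geomTorsion ((p ^ M : ℕ) : ℤ) :=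
      pow_apply_mem_geomTorsion W _ hX_M
    have ht₀d : (μ ^ d) ((μ ^ (e i - d)) X) = 0 := by
      change (μ ^ d * μ ^ (e i - d)) X = 0
      rw [← pow_add, show d + (e i - d) = e i by omega]
      exact he i _ hρ₁
    have ht₀d' : (μ ^ (d - 1)) ((μ ^ (e i - d)) X) ≠ 0 := by
      change (μ ^ (d - 1) * μ ^ (e i - d)) X ≠ 0
      rw [← pow_add, show d - 1 + (e i - d) = e i - 1 by omega]
      exact hρ₁top
    obtain ⟨t, htM, hteig, htd, htd'⟩ := exists_eigen_exactDepth W p hc₀ hs hanti hp2 hηs hη hd1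
      ht₀M ht₀d ht₀d'
    have hteig' : c₀ • t = ν i • t := by rw [hteig, hpar, hsign i hNi]
    refine ⟨(RatClosure.torsionEquiv (K := K) W ((p ^ M : ℕ) : ℤ)) ⟨t, htM⟩, ?_, ?_, fun a ↦ ?_⟩
    · rw [(RatClosure.torsionEquiv (K := K) W ((p ^ M : ℕ) : ℤ)).symm_apply_apply]
      exact (pow_apply_eq_zero_iff_le W htd (Or.inr htd') (e i)).mpr hde
    · rw [← RatClosure.torsionEquiv_smul_of_lift W ht c₀ (fun _ ↦ rfl) ((p ^ M : ℕ) : ℤ) ⟨t, htM⟩,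
        ← map_zsmul]
      congr 1
      exact Subtype.ext (by
        change c₀ • t = ((ν i • (⟨t, htM⟩ : W.geomTorsion ((p ^ M : ℕ) : ℤ)) :
          W.geomTorsion ((p ^ M : ℕ) : ℤ)) : W.geomPoints)
        rw [AddSubgroupClass.coe_zsmul]; exact hteig')
    · rw [← map_zsmul, AddEquiv.map_eq_zero_iff,
        show (((p : ℤ) ^ a) • (⟨t, htM⟩ : W.geomTorsion ((p ^ M : ℕ) : ℤ)) = 0) ↔
          ((p : ℤ) ^ a) • t = 0 from
          ⟨fun h ↦ by
              have h' := congrArg Subtype.val h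
              rw [AddSubgroupClass.coe_zsmul, ZeroMemClass.coe_zero] at h'
              exact h',
            fun h ↦ Subtype.ext (by rw [AddSubgroupClass.coe_zsmul, ZeroMemClass.coe_zero]; exact h)⟩,
        pow_zsmul_eq_zero_iff_le_two_mul W p hm hμμ htd (Or.inr htd') a]
      omega
  choose T hTe hTν hTord using htarget
  -- FILE 1: realiser + Kolyvagin prime with kernel = kernel of `[·, ρ]`
  obtain ⟨ρ, hρT, hρt, ℓ, hbℓ, hℓ, hℓN, hℓD, hℓp, hprime, hfrob, hloc⟩ :=
    exists_kolyvaginPrime_gt_pow_kernel_of_cmRamified W p K hC (N := N) hCM h5 hram hs hm hμμ hcomm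
      hK hM hc₀ ht hinv xs hxs e he hind T hTe hTν b
  refine ⟨ℓ, hbℓ, hℓ, hℓN, hℓD, hℓp, hprime, hfrob, fun i v hv ↦ ?_⟩
  have hmem : ∀ a : ℕ, ((p : ℤ) ^ a) • xs i ∈ AddSubgroup.closure (Set.range xs) := fun a ↦
    AddSubgroup.zsmul_mem _ (AddSubgroup.subset_closure (Set.mem_range_self i)) _
  have hkey : ∀ a : ℕ, ((p : ℤ) ^ a) • xs i ∈
      (W.baseChange K).torsionLocalKer (v.adicCompletion K) ((p ^ M : ℕ) : ℤ) ↔ Nv i ≤ a := by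
    intro a
    rw [hloc _ (hmem a) v hv, h1Eval_zsmul _ _ _ _ hρT, hρt i, hTord]
  exact ⟨(hkey _).mpr le_rfl, fun hNi h ↦ by have := (hkey _).mp h; omega⟩

end Summit.BirchSwinnertonDyer.BirchSwinnertonDyer.Theorems.PrintCFram.BorelKolyvaginPairing

end
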